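import Literature.Analysis.PDE.WeakHarnackAbsorb
import Literature.Analysis.PDE.WeakHarnackAffine
import HarnessLib

/-!
# The rescaled and level-shifted measure-to-supremum step (Gilbarg–Trudinger (9.56))

Transport of `negLog_le_of_small_measure` (the unit-ball statement) along the affine map
`T(x) = z + s • x` and the level shift `ū ↦ e^k ū` ("the estimate (9.56) still holds when `w` is
replaced by `w - k`"): for a sub-ball `B̄_s(z) ⊆ B̄₁`, if `{e^k (u+N) < 1}` has small measure in
`B_s(z) ∩ B_{αs}(z)` then `-log(u+N) ≤ k + C_ρ` on `B̄_{ρs}(z)` (`negLog_le_on_subball`).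

## References

* D. Gilbarg, N. S. Trudinger, *Elliptic Partial Differential Equations of Second Order* (2001),
  proof of Theorem 9.22, (9.55)–(9.56) and the remark before Lemma 9.23's application.
  [GilbargTrudinger2001]
-/

noncomputable section

open Set InnerProductSpace RealInnerProductSpace Matrix Filter Metric MeasureTheory
open scoped Topology ENNReal

namespace Literature.Analysis.PDE.KrylovSafonov

open Literature.Analysis.PDE.ABP

variable {E : Type*} [NormedAddCommGroup E] [InnerProductSpace ℝ E] [FiniteDimensional ℝ E]
  [MeasurableSpace E] [BorelSpace E] {ι : Type*} [Fintype ι] [DecidableEq ι]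

omit [FiniteDimensional ℝ E] [MeasurableSpace E] [BorelSpace E] [DecidableEq ι] in
/-- The Hessian matrix of a constant multiple. [folklore] -/
theorem hessianMatrix_const_mul (b : OrthonormalBasis ι ℝ E) (c : ℝ) {g : E → ℝ} {x : E}
    (hg : ∀ᶠ y in 𝓝 x, DifferentiableAt ℝ g y) (hg2 : DifferentiableAt ℝ (fderiv ℝ g) x) :
    hessianMatrix (fun y ↦ c * g y) b x = c • hessianMatrix g b x := by
  have h1 : fderiv ℝ (fun y ↦ c * g y) =ᶠ[𝓝 x] fun y ↦ c • fderiv ℝ g y := by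
    filter_upwards [hg] with y hy
    exact fderiv_const_mul hy c
  have h2 : HasFDerivAt (fderiv ℝ (fun y ↦ c * g y)) (c • fderiv ℝ (fderiv ℝ g) x) x :=
    (hg2.hasFDerivAt.const_smul c).congr_of_eventuallyEq h1
  ext i j
  rw [hessianMatrix_apply, h2.fderiv]
  simp [hessianMatrix_apply]

/-- **(9.56), rescaled and level-shifted.** Under the unit-ball hypotheses of
`negLog_le_of_small_measure`, for `B̄_s(z) ⊆ B̄₁` (`0 < s ≤ 1`) and `k : ℝ`: if
`μ({y ∈ B_s(z) | e^k (u y + N) < 1} ∩ B_{αs}(z)) ≤ θ₀ μ(B_s(z))` then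
`-log(u y + N) ≤ k + C₁/(1-ρ²)^{m+2}` for `‖y - z‖ ≤ ρ s`.
[cite: GilbargTrudinger2001, proof of Thm 9.22, (9.56)] -/
theorem negLog_le_on_subball [Nonempty ι] (μ : Measure E) [μ.IsAddHaarMeasure]
    (b : OrthonormalBasis ι ℝ E) {U : Set E} (hU : IsOpen U) (hBU : closedBall (0 : E) 1 ⊆ U)
    {u f : E → ℝ} {N : ℝ} (hu : ContDiffOn ℝ 2 u U) (hu0 : ∀ y ∈ closedBall (0 : E) 1, 0 ≤ u y)
    (hN : 0 < N) (hf : ∀ y ∈ ball (0 : E) 1, |f y| ≤ N)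
    {a : E → Matrix ι ι ℝ} (ha : ∀ y ∈ ball (0 : E) 1, (a y).IsSymm) {lam Λ : ℝ} (hlam0 : 0 < lam)
    (hΛ0 : 0 ≤ Λ) (hlam : ∀ y ∈ ball (0 : E) 1, ∀ ξ : ι → ℝ, lam * (ξ ⬝ᵥ ξ) ≤ ξ ⬝ᵥ (a y *ᵥ ξ))
    (hΛ : ∀ y ∈ ball (0 : E) 1, ∀ ξ : ι → ℝ, ξ ⬝ᵥ (a y *ᵥ ξ) ≤ Λ * (ξ ⬝ᵥ ξ))
    (hsuper : ∀ y ∈ ball (0 : E) 1, pair (a y) (hessianMatrix u b y) ≤ f y)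
    {m : ℕ} {α : ℝ} (hα0 : 0 < α) (hα1 : α ^ 2 < 1)
    (hβl : Fintype.card ι * Λ ≤ 2 * (((m + 2 : ℕ) : ℝ) - 1) * lam * α ^ 2)
    {z : E} {s : ℝ} (hs0 : 0 < s) (hs1 : s ≤ 1) (hzs : closedBall z s ⊆ closedBall (0 : E) 1)
    (k : ℝ)
    (hθ : μ ({y | y ∈ ball z s ∧ Real.exp k * (u y + N) < 1} ∩ ball z (α * s)) ≤
      ENNReal.ofReal (thetaZero (Fintype.card ι) lam Λ m α) * μ (ball z s))
    {ρ : ℝ} (hρ0 : 0 ≤ ρ) (hρ1 : ρ < 1) {y : E} (hy : ‖y - z‖ ≤ ρ * s) :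
    -Real.log (u y + N) ≤ k + supBound (Fintype.card ι) lam Λ m / (1 - ρ ^ 2) ^ (m + 2) := by
  set T := affineMap z s with hT
  set ek := Real.exp k with hek
  have hek0 : 0 < ek := Real.exp_pos k
  -- images of balls under `T`
  have hTball : ∀ x : E, T x ∈ ball z s ↔ x ∈ ball (0 : E) 1 := fun x ↦ by
    rw [mem_ball, dist_eq_norm, hT, norm_affineMap_sub, abs_of_pos hs0, mem_ball_zero_iff]
    constructor
    · intro h; nlinarith
    · intro h; nlinarith
  have hTballα : ∀ x : E, T x ∈ ball z (α * s) ↔ x ∈ ball (0 : E) α := fun x ↦ by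
    rw [mem_ball, dist_eq_norm, hT, norm_affineMap_sub, abs_of_pos hs0, mem_ball_zero_iff]
    constructor
    · intro h; nlinarith
    · intro h; nlinarith
  have hTclosed : ∀ x ∈ closedBall (0 : E) 1, T x ∈ closedBall (0 : E) 1 := fun x hx ↦ by
    apply hzs
    rw [mem_closedBall, dist_eq_norm, hT, norm_affineMap_sub, abs_of_pos hs0]
    have := mem_closedBall_zero_iff.1 hx
    nlinarith
  have hTB : ∀ x ∈ ball (0 : E) 1, T x ∈ ball (0 : E) 1 := fun x hx ↦ by
    have h1 : T x ∈ ball z s := (hTball x).2 hx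
    have h2 : ball z s ⊆ ball (0 : E) 1 := by
      have : ball z s ⊆ interior (closedBall (0 : E) 1) :=
        (interior_maximal ball_subset_closedBall isOpen_ball).trans (interior_mono hzs)
      rwa [interior_closedBall 0 one_ne_zero] at this
    exact h2 h1
  -- the transported data
  set u' : E → ℝ := fun x ↦ ek * u (T x) with hu'
  set f' : E → ℝ := fun x ↦ ek * (s ^ 2 * f (T x)) with hf'
  set a' : E → Matrix ι ι ℝ := fun x ↦ a (T x) with ha'
  set U' : Set E := T ⁻¹' U with hU'
  have hU'o : IsOpen U' := isOpen_preimage_affineMap hU z s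
  have hBU' : closedBall (0 : E) 1 ⊆ U' := fun x hx ↦ hBU (hTclosed x hx)
  have hcomp : ContDiffOn ℝ 2 (u ∘ T) U' := contDiffOn_comp_affineMap hu z s
  have hu'c : ContDiffOn ℝ 2 u' U' := contDiffOn_const.mul hcomp
  have hu'0 : ∀ x ∈ closedBall (0 : E) 1, 0 ≤ u' x := fun x hx ↦
    mul_nonneg hek0.le (hu0 _ (hTclosed x hx))
  have hN' : 0 < ek * N := mul_pos hek0 hN
  have hf'b : ∀ x ∈ ball (0 : E) 1, |f' x| ≤ ek * N := fun x hx ↦ by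
    rw [hf', abs_mul, abs_of_pos hek0, abs_mul, abs_of_nonneg (sq_nonneg s)]
    refine mul_le_mul_of_nonneg_left ?_ hek0.le
    have h1 : |f (T x)| ≤ N := hf _ (hTB x hx)
    have h2 : s ^ 2 ≤ 1 := by nlinarith
    nlinarith [abs_nonneg (f (T x))]
  have ha's : ∀ x ∈ ball (0 : E) 1, (a' x).IsSymm := fun x hx ↦ ha _ (hTB x hx)
  have hlam' : ∀ x ∈ ball (0 : E) 1, ∀ ξ : ι → ℝ, lam * (ξ ⬝ᵥ ξ) ≤ ξ ⬝ᵥ (a' x *ᵥ ξ) :=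
    fun x hx ↦ hlam _ (hTB x hx)
  have hΛ' : ∀ x ∈ ball (0 : E) 1, ∀ ξ : ι → ℝ, ξ ⬝ᵥ (a' x *ᵥ ξ) ≤ Λ * (ξ ⬝ᵥ ξ) :=
    fun x hx ↦ hΛ _ (hTB x hx)
  -- the transported equation
  have hsuper' : ∀ x ∈ ball (0 : E) 1, pair (a' x) (hessianMatrix u' b x) ≤ f' x := by
    intro x hx
    have hTxB : T x ∈ ball (0 : E) 1 := hTB x hx
    have hTxU : T x ∈ U := hBU (ball_subset_closedBall hTxB)
    have hev : ∀ᶠ y in 𝓝 (T x), DifferentiableAt ℝ u y := by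
      filter_upwards [hU.mem_nhds hTxU] with y hy
      exact (hu.differentiableOn (by norm_num)).differentiableAt (hU.mem_nhds hy)
    have hu2 : DifferentiableAt ℝ (fderiv ℝ u) (T x) :=
      ((hu.fderiv_of_isOpen hU (m := 1) (by norm_num)).differentiableOn one_ne_zero).differentiableAt
        (hU.mem_nhds hTxU)
    have hH1 : hessianMatrix (u ∘ T) b x = s ^ 2 • hessianMatrix u b (T x) :=
      hessianMatrix_comp_affineMap b hev hu2
    -- `u ∘ T` is differentiable near `x` with differentiable derivative
    have hxU' : x ∈ U' := hBU' (ball_subset_closedBall hx)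
    have hevT : ∀ᶠ y in 𝓝 x, DifferentiableAt ℝ (u ∘ T) y := by
      filter_upwards [hU'o.mem_nhds hxU'] with y hy
      exact (hcomp.differentiableOn (by norm_num)).differentiableAt (hU'o.mem_nhds hy)
    have hT2 : DifferentiableAt ℝ (fderiv ℝ (u ∘ T)) x :=
      ((hcomp.fderiv_of_isOpen hU'o (m := 1) (by norm_num)).differentiableOn one_ne_zero).differentiableAt
        (hU'o.mem_nhds hxU')
    have hH2 : hessianMatrix u' b x = ek • hessianMatrix (u ∘ T) b x :=
      hessianMatrix_const_mul b ek hevT hT2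
    rw [hH2, hH1, smul_smul, pair_smul]
    have h := hsuper _ hTxB
    have hc : 0 ≤ ek * s ^ 2 := by positivity
    calc ek * s ^ 2 * pair (a' x) (hessianMatrix u b (T x)) ≤ ek * s ^ 2 * f (T x) :=
          mul_le_mul_of_nonneg_left h hc
      _ = f' x := by rw [hf']; ring
  -- the transported smallness hypothesis
  set n := Fintype.card ι with hn
  have hfin : Module.finrank ℝ E = n := by rw [hn, Module.finrank_eq_card_basis b.toBasis]
  have hpre : ∀ A : Set E, μ (T ⁻¹' A) = ENNReal.ofReal |(s ^ n)⁻¹| * μ A := fun A ↦ by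
    have : T ⁻¹' A = (fun x : E ↦ s • x) ⁻¹' ((fun x : E ↦ z + x) ⁻¹' A) := by
      ext x; simp [hT, affineMap]
    rw [this, Measure.addHaar_preimage_smul μ hs0.ne', measure_preimage_add, hfin]
  have hθ' : μ ({x | x ∈ ball (0 : E) 1 ∧ u' x + ek * N < 1} ∩ ball (0 : E) α) ≤
      ENNReal.ofReal (thetaZero n lam Λ m α) * μ (ball (0 : E) 1) := by
    have hset : {x | x ∈ ball (0 : E) 1 ∧ u' x + ek * N < 1} ∩ ball (0 : E) α =
        T ⁻¹' ({y | y ∈ ball z s ∧ ek * (u y + N) < 1} ∩ ball z (α * s)) := by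
      ext x
      simp only [mem_inter_iff, mem_setOf_eq, mem_preimage, hTball x, hTballα x, hu']
      constructor
      · rintro ⟨⟨h1, h2⟩, h3⟩; exact ⟨⟨h1, by rw [mul_add]; exact h2⟩, h3⟩
      · rintro ⟨⟨h1, h2⟩, h3⟩; exact ⟨⟨h1, by rw [mul_add] at h2; exact h2⟩, h3⟩
    have hball : ball (0 : E) 1 = T ⁻¹' (ball z s) := by
      ext x; rw [mem_preimage]; exact (hTball x).symm
    rw [hset, hball, hpre, hpre, mul_left_comm]
    exact mul_le_mul_right hθ _
  -- apply the unit-ball statement to the transported data at `y' = s⁻¹ (y - z)`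
  set y' : E := s⁻¹ • (y - z) with hy'
  have hTy : T y' = y := by
    rw [hT, affineMap, hy', smul_smul, mul_inv_cancel₀ hs0.ne', one_smul, add_sub_cancel]
  have hy'ρ : ‖y'‖ ≤ ρ := by
    rw [hy', norm_smul, Real.norm_eq_abs, abs_inv, abs_of_pos hs0]
    rw [inv_mul_le_iff₀ hs0]; linarith
  have hP := negLog_le_of_small_measure μ b hU'o hBU' hu'c hu'0 hN' hf'b ha's hlam0 hΛ0 hlam' hΛ'
    hsuper' hα0 hα1 hβl hθ' hρ0 hρ1 hy'ρ
  -- `-log(e^k (u y + N)) = -k - log(u y + N)`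
  have hyB : y ∈ closedBall (0 : E) 1 := by
    rw [← hTy]; exact hTclosed y' (mem_closedBall_zero_iff.2 (hy'ρ.trans hρ1.le))
  have hūpos : 0 < u y + N := by linarith [hu0 y hyB]
  have hlog : -Real.log (u' y' + ek * N) = -k - Real.log (u y + N) := by
    rw [hu']
    simp only [hTy]
    rw [← mul_add, Real.log_mul hek0.ne' hūpos.ne', hek, Real.log_exp]
    ring
  rw [hlog] at hP
  linarith

end Literature.Analysis.PDE.KrylovSafonov

end
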